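import Literature.NumberTheory.EllipticCurves.Kato2004.IwasawaH1LayerResInjectiveProofs
import Literature.NumberTheory.EllipticCurves.Kato2004.IwasawaH1ReductionKernel
import HarnessLib

/-!
# A UNIFORM bound for the torsion of `H¹(ℚ_n, T_pW)` along a `ℤ_p`-tower: one exponent `c` with
# `p^c · H¹(ℚ_n, T_pW)[p^∞] = 0` for every layer `n` — every elliptic `E/ℚ`, every prime `p`

Topic `NumberTheory/EllipticCurves`, sub-directory `Kato2004` (helper namespace `IwasawaH1LayerNorm`,
continued).  THEOREMS ONLY (no definition, no named fact, no `sorry`).  Cell `bsd-potss` (seat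
`bsd-potss-rkm` g7, item stmt-BirchSwinnertonDyer-19196; Kato-infrastructure on the pin
`Kato2004.IwasawaH1Data`).  The torsion subgroup of `H¹(ℚ_n, T_pW)` is the image of the Kummer boundary
`E(ℚ_n)[p^∞] = H⁰(ℚ_n, W[p^∞]) → H¹(ℚ_n, T_pW)`; since `E(ℚ_∞)[p^∞]` is FINITE (tree,
`WeierstrassCurve.finite_fixedPoints_kerSubgroup_geomPrimaryTorsion_rat`, Greenberg LNM 1716 §1), its
exponent is bounded by ONE power `p^c` for all layers `ℚ_n` of the `ℤ_p`-extension at once.  We prove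
this on continuous cochains, without the boundary map: if `p^k • [φ] = 0` then `p^k φ = ∂m` with
`m mod p^k ∈ W[p^k]^{Γ_n}`, so `p^c m ∈ p^k T_pW` (the uniform exponent
`IwasawaH1LayerNorm.exists_pow_smul_eq_zero_of_forall_smul_eq` and `ker (T_pW → W[p^k]) = p^k T_pW`),
`p^c m = p^k b`, and cancelling `p^k` in the torsion-free `T_pW` gives `p^c φ = ∂b`.

* `exists_pow_smul_eq_of_proj_eq_zero` — `ker (a ↦ a_k : T_pW → W[p^k]) = p^k · T_pW`.
* `eq_of_pow_smul_eq` — `p^k • a = p^k • b → a = b` in `T_pW`.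
* **`exists_forall_pow_smul_eq_zero_of_pow_smul_eq_zero`** — `∃ c, ∀ n k y, p^k • y = 0 → p^c • y = 0`
  on `H¹(ℚ_n, T_pW)` (`y ∈ H1 (tateRep W p) (κ.layerSubgroup n)`, scalars `(p : ℤ_p)^k`).

## References

* [GreenbergLNM1716] R. Greenberg, *Iwasawa theory for elliptic curves*, LNM 1716 (1999), §1 p. 62,
  §3 p. 86 (finiteness of `E(ℚ_∞)[p^∞]`); §3–§4 (control of Selmer/cohomology groups up the tower).
* [Rubin2000] K. Rubin, *Euler Systems* (2000), App. B §2–§3 (`H¹(K, T)`, `T = lim T/p^n`, torsion).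
* [Kato2004Asterisque] K. Kato, Astérisque 295 (2004), §13.8 (p. 228) (`T → T/p^k` on cochains).
* [SilvermanAEC2009] J. H. Silverman, *AEC* (2009), III §7 (the Tate module).
* Tree: `Kato2004/IwasawaH1LayerNormProofs.lean`, `…/IwasawaH1LayerResInjectiveProofs.lean`
  (`pow_smul_proj_add`), `…/IwasawaH1ReductionKernel.lean` (`TateModule.eq_of_prime_nsmul_eq`,
  `TateModule.exists_prime_nsmul_eq_of_proj_one_eq_zero`), `…/IwasawaH1ReductionPk.lean` (`tateModPk`).
-/

noncomputable section

open scoped NumberField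
open Field CategoryTheory
open Literature.NumberTheory.GaloisRepresentations
open Literature.NumberTheory.EllipticCurves Literature.NumberTheory.EllipticCurves.Kato2004
open Literature.NumberTheory.EllipticCurves.Kato2004.EulerSystemValues
open WeierstrassCurve (geomPoints geomTorsion geomPrimaryTorsion)

namespace Literature.NumberTheory.EllipticCurves.Kato2004

namespace IwasawaH1LayerNorm

variable {p : ℕ} [hp : Fact p.Prime] (W : WeierstrassCurve ℚ) [W.IsElliptic]

/-! ## Two lemmas on the Tate module: `ker (a ↦ a_k) = p^k T_pW` and cancellation of `p^k` -/

omit hp [W.IsElliptic] in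
/-- **`ker (T_pW → W[p^k]) = p^k · T_pW`**: if the `k`-th component of `a ∈ T_pW` vanishes, then
`a = p^k • b` for some `b` (induction on `k` from the case `k = 1`,
`TateModule.exists_prime_nsmul_eq_of_proj_one_eq_zero`; `a_1 = p^k • a_{k+1}`).
[cite: SilvermanAEC2009, III §7] -/
theorem exists_pow_smul_eq_of_proj_eq_zero (k : ℕ) (a : W.tateModule p)
    (ha : TateModule.proj p k a = 0) : ∃ b : W.tateModule p, p ^ k • b = a := by
  induction k generalizing a with
  | zero => exact ⟨a, by rw [pow_zero, one_smul]⟩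
  | succ k ih =>
    have h1 : TateModule.proj p 1 a = 0 := by
      rw [← pow_smul_proj_add W k 1 a, Nat.add_comm, ha, smul_zero]
    obtain ⟨a', ha', hproj⟩ := TateModule.exists_prime_nsmul_eq_of_proj_one_eq_zero a h1
    obtain ⟨b, hb⟩ := ih a' (by rw [hproj, ha])
    exact ⟨b, by rw [pow_succ', mul_smul, hb, ha']⟩

omit hp [W.IsElliptic] in
/-- **Cancellation of `p^k` in `T_pW`**: `p^k • a = p^k • b → a = b` (`T_pW` is torsion-free,
`TateModule.eq_of_prime_nsmul_eq`). [cite: SilvermanAEC2009, III §7] -/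
theorem eq_of_pow_smul_eq (k : ℕ) {a b : W.tateModule p} (h : p ^ k • a = p ^ k • b) : a = b := by
  induction k generalizing a b with
  | zero => rwa [pow_zero, one_smul, one_smul] at h
  | succ k ih =>
    rw [pow_succ', mul_smul, mul_smul] at h
    exact ih (TateModule.eq_of_prime_nsmul_eq h)

/-! ## The uniform torsion bound -/

variable [ContinuousSMul ℤ_[p] (W.tateModule p)] (κ : ZpExtension ℚ p)

/-- **Uniform exponent for the torsion of `H¹(ℚ_n, T_pW)` along the tower.** For every elliptic curve
`E/ℚ`, prime `p` and `ℤ_p`-extension `κ` of `ℚ` there is `c` such that for EVERY layer `n`, every `k`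
and every `y ∈ H¹(ℚ_n, T_pW)`: `p^k • y = 0 → p^c • y = 0` (the torsion of `H¹(ℚ_n, T_pW)` is
`E(ℚ_n)[p^∞] ⊂ E(ℚ_∞)[p^∞]`, finite of order dividing `p^c`).  On cochains: `p^k φ = ∂m`,
`m mod p^k ∈ W[p^k]^{Γ_n}` is killed by `p^c`, so `p^c m = p^k b` and `p^c φ = ∂b`.
[cite: GreenbergLNM1716, §1 p. 62 and §3 p. 86] [cite: Rubin2000, App. B §2] -/
theorem exists_forall_pow_smul_eq_zero_of_pow_smul_eq_zero :
    ∃ c : ℕ, ∀ (n k : ℕ) (y : H1 (tateRep W p) (κ.layerSubgroup n)),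
      ((p : ℤ_[p]) ^ k) • y = 0 → ((p : ℤ_[p]) ^ c) • y = 0 := by
  obtain ⟨c, hc⟩ := exists_pow_smul_eq_zero_of_forall_smul_eq (p := p) W κ
  refine ⟨c, fun n k y hy => ?_⟩
  obtain ⟨φ, rfl⟩ := oneCocycleClass_surjective _ y
  -- the actions of `Γ_n` on `T_pW|_{Γ_n}` are the Galois action
  have hρ : ∀ (g : κ.layerSubgroup n) (a : W.tateModule p),
      (subgroupRep (tateRep W p).toTopRep (κ.layerSubgroup n)).ρ g a =
        (g : absoluteGaloisGroup ℚ) • a := fun g a => rfl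
  -- `p^k φ = ∂m`
  rw [← oneCocycleClass_smul, oneCocycleClass_eq_zero_iff] at hy
  obtain ⟨m₀, hm⟩ := hy
  set m : W.tateModule p := m₀ with hmdef
  have hm' : ∀ g : κ.layerSubgroup n,
      p ^ k • (φ.1 g : W.tateModule p) = (g : absoluteGaloisGroup ℚ) • m - m := fun g => by
    have h := hm g
    rw [Submodule.coe_smul, ContinuousMap.smul_apply, ← Nat.cast_pow, Nat.cast_smul_eq_nsmul, hρ] at h
    exact h
  -- `m mod p^k` is `Γ_n`-fixed, hence killed by `p^c`; so `(p^c m)_k = 0`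
  have hfix : ∀ g ∈ κ.layerSubgroup n, g • tateModPk W p k m = tateModPk W p k m := by
    intro g hg
    have hgm : g • m = p ^ k • (φ.1 ⟨g, hg⟩ : W.tateModule p) + m :=
      sub_eq_iff_eq_add.mp (hm' ⟨g, hg⟩).symm
    rw [← tateModPk_smul]
    apply Subtype.ext
    rw [coe_tateModPk_apply, coe_tateModPk_apply, hgm, map_add, map_nsmul, TateModule.pow_smul_proj,
      zero_add]
  have hck : TateModule.proj p k (p ^ c • m) = 0 := by
    have h := congrArg (fun v : geomTorsion W ((p : ℤ) ^ k) => (v : geomPoints W)) (hc k n _ hfix)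
    simp only [AddSubmonoidClass.coe_nsmul, coe_tateModPk_apply, ZeroMemClass.coe_zero] at h
    rwa [map_nsmul]
  -- `p^c m = p^k b`
  obtain ⟨b, hb⟩ := exists_pow_smul_eq_of_proj_eq_zero W k (p ^ c • m) hck
  -- `p^c φ = ∂b` after cancelling `p^k`
  have hgb : ∀ g : κ.layerSubgroup n,
      (g : absoluteGaloisGroup ℚ) • (p ^ k • b) = p ^ k • ((g : absoluteGaloisGroup ℚ) • b) :=
    fun g => smul_comm _ _ _
  have hgm' : ∀ g : κ.layerSubgroup n,
      (g : absoluteGaloisGroup ℚ) • (p ^ c • m) = p ^ c • ((g : absoluteGaloisGroup ℚ) • m) :=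
    fun g => smul_comm _ _ _
  have hφ : ∀ g : κ.layerSubgroup n,
      p ^ c • (φ.1 g : W.tateModule p) = (g : absoluteGaloisGroup ℚ) • b - b := fun g => by
    apply eq_of_pow_smul_eq W k
    calc p ^ k • (p ^ c • (φ.1 g : W.tateModule p))
        = p ^ c • (p ^ k • (φ.1 g : W.tateModule p)) := by rw [smul_smul, mul_comm, ← smul_smul]
      _ = p ^ c • ((g : absoluteGaloisGroup ℚ) • m) - p ^ c • m := by rw [hm' g, nsmul_sub]
      _ = (g : absoluteGaloisGroup ℚ) • (p ^ k • b) - p ^ k • b := by rw [hb, hgm' g]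
      _ = p ^ k • ((g : absoluteGaloisGroup ℚ) • b - b) := by rw [hgb g, nsmul_sub]
  rw [← oneCocycleClass_smul, oneCocycleClass_eq_zero_iff]
  refine ⟨b, fun g => ?_⟩
  rw [Submodule.coe_smul, ContinuousMap.smul_apply, ← Nat.cast_pow, Nat.cast_smul_eq_nsmul, hρ]
  exact hφ g

end IwasawaH1LayerNorm

end Literature.NumberTheory.EllipticCurves.Kato2004

end
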